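import Literature.Computability.Cryptography.WordRAMBlocks
import HarnessLib

/-!
# The word RAM — `for`-loops and register files

A second layer of the verification calculus for concrete word-RAM programs
(`Literature.Computability.Cryptography.WordRAM`, runs and step equations in `…WordRAMExec`,
blocks at an offset `CodeAt`, straight-line operations `OpSpec`/`execOps`/`run_ops` and
count-*down* loops `loopBlock` in `…WordRAMBlocks`); it is the layer on which the verified
implementation of Floyd's Algorithm 97 (`APSP_inTimeO_cube`) is built:

* `codeAtB` / `codeAt_of_codeAtB`: a Boolean check of `CodeAt` for concrete programs
  (`codeAt_of_codeAtB (by decide +kernel)` places every block of a 200-instruction program).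
* `forLoop T Q LIM L EXIT body`: the count-*up* loop `L: T := (Q < LIM); jz T EXIT; body;
  Q := Q + 1; jmp L` over three register cells (flag `T`, counter `Q`, limit `LIM`) — the shape
  `for Q := Q₀ step 1 until LIM - 1` of Floyd's ALGOL loops, with the counter available to the
  body for address arithmetic; its one-iteration memory transformer `forStep`, and
  `run_forLoop_iter` (`|body| + 4` steps per iteration while `Q < LIM`), `run_forLoop_exit`
  (`2` steps to `EXIT` once `Q ≥ LIM`), `run_forLoop` (`K` iterations take exactly
  `K (|body| + 4)` steps and compute `forStep^[K]`, as long as the counter stays below the limit).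
* `regMem rs heap`: a memory whose first `|rs|` cells — the *registers*, addressed by literals in
  the program text — hold the listed values, the other cells being given by `heap`; with the four
  read/write lemmas `regMem_apply_lt`, `regMem_apply_of_le`, `update_regMem_lt`,
  `update_regMem_of_le` that let `simp` execute a straight-line block symbolically on such a
  memory (register reads become list look-ups, register writes become `List.set`).

## References

* T. Hagerup, *Sorting and searching on the word RAM*, STACS 1998, §2 (the machine model).
* R. W. Floyd, *Algorithm 97: Shortest path*, Comm. ACM 5 (6) (1962), p. 345 (the `for` loops
  being mechanised).
* R. W. Floyd, *Assigning meanings to programs*, Proc. Sympos. Appl. Math. 19 (1967), 19–32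
  (inductive assertions along a loop, the content of `run_forLoop`).
-/

namespace Literature.Computability.Cryptography.WordRAM

open StateTransition

/-! ## Boolean placement check -/

/-- Boolean check of `CodeAt P p B` (for concrete programs: `codeAt_of_codeAtB (by decide)`).
[folklore] -/
def codeAtB (P : Program) (p : ℕ) (B : List Instr) : Bool :=
  (List.range B.length).all fun t => P[p + t]? == B[t]?

/-- `CodeAt` from its Boolean check. [folklore] -/
theorem codeAt_of_codeAtB {P : Program} {p : ℕ} {B : List Instr} (h : codeAtB P p B = true) :
    CodeAt P p B := by
  intro j I hj
  have hjl : j < B.length := by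
    by_contra hc
    rw [List.getElem?_eq_none (Nat.not_lt.1 hc)] at hj
    exact absurd hj (by simp)
  have := List.all_eq_true.1 h j (List.mem_range.2 hjl)
  rw [beq_iff_eq] at this
  rw [this, hj]

/-! ## `for`-loops -/

/-- The code of a count-up loop with head at `L`: `T := (Q < LIM); jz T EXIT; body; Q := Q + 1;
jmp L` (flag, counter and limit are the memory cells `T`, `Q`, `LIM`). Floyd 1962 (the ALGOL
`for i := 1 step 1 until n do` loops of Algorithm 97). [folklore] -/
def forLoop (T Q LIM L EXIT : ℕ) (body : List OpSpec) : List Instr :=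
  [.op .lt (.dir T) (.dir Q) (.dir LIM), .jz (.dir T) EXIT] ++ body.map OpSpec.toInstr ++
    [.op .add (.dir Q) (.dir Q) (.imm 1), .jmp L]

/-- The length of a `for`-loop's code. [folklore] -/
@[simp] theorem forLoop_length (T Q LIM L EXIT : ℕ) (body : List OpSpec) :
    (forLoop T Q LIM L EXIT body).length = body.length + 4 := by
  simp [forLoop]

/-- The effect of one iteration of a `for`-loop on memory: set the flag `T := 1`, run the body,
increment the counter `Q` (modulo `2 ^ w`). [folklore] -/
def forStep (w T Q : ℕ) (body : List OpSpec) (mem : ℕ → ℕ) : ℕ → ℕ :=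
  Function.update (execOps w (Function.update mem T 1) body) Q
    ((execOps w (Function.update mem T 1) body Q + 1) % 2 ^ w)

section forLoop

variable {P : Program} {w : ℕ} {O : List ℕ → List ℕ} {ρ : ℕ → ℕ} {T Q LIM L EXIT : ℕ}
  {body : List OpSpec}

/-- **One iteration.** If the counter is below the limit, a `for`-loop runs its body once,
increments the counter and returns to its head, in `|body| + 4` steps. [folklore] -/
theorem run_forLoop_iter (h : CodeAt P L (forLoop T Q LIM L EXIT body)) {mem : ℕ → ℕ}
    (hlt : mem Q < mem LIM) (cp : ℕ) (qs : List (List ℕ)) :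
    run P w O ρ (body.length + 4) ⟨some L, mem, cp, qs⟩ =
      some ⟨some L, forStep w T Q body mem, cp, qs⟩ := by
  have hc : CodeAt P L (([.op .lt (.dir T) (.dir Q) (.dir LIM), .jz (.dir T) EXIT] ++
      body.map OpSpec.toInstr) ++ [.op .add (.dir Q) (.dir Q) (.imm 1), .jmp L]) := h
  obtain ⟨h12b, h34⟩ := codeAt_append_iff.1 hc
  obtain ⟨h12, hb⟩ := codeAt_append_iff.1 h12b
  simp only [List.length_append, List.length_cons, List.length_nil, List.length_map,
    Nat.zero_add] at hb h34
  -- step 1: `T := (Q < LIM) = 1`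
  have s1 : step P w O ρ ⟨some L, mem, cp, qs⟩ =
      some ⟨some (L + 1), Function.update mem T 1, cp, qs⟩ := by
    rw [step_op (c := ⟨some L, mem, cp, qs⟩) rfl h12.getElem?_zero]
    simp [BinOp.eval, hlt, Operand.write]
  -- step 2: `jz T EXIT`, not taken
  have s2 : step P w O ρ ⟨some (L + 1), Function.update mem T 1, cp, qs⟩ =
      some ⟨some (L + 2), Function.update mem T 1, cp, qs⟩ := by
    rw [step_jz_ne (c := ⟨some (L + 1), _, cp, qs⟩) rfl h12.tail.getElem?_zero (by simp)]
  -- the body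
  have s3 := run_ops (P := P) (w := w) (O := O) (ρ := ρ) body hb
    (c := ⟨some (L + 2), Function.update mem T 1, cp, qs⟩) rfl
  -- step: `Q := Q + 1`
  set m := execOps w (Function.update mem T 1) body with hm
  have s4 : step P w O ρ ⟨some (L + 2 + body.length), m, cp, qs⟩ =
      some ⟨some (L + 2 + body.length + 1), forStep w T Q body mem, cp, qs⟩ := by
    rw [step_op (c := ⟨some (L + 2 + body.length), m, cp, qs⟩) rfl
      (by simpa [Nat.add_assoc] using h34.getElem?_zero)]
    simp [BinOp.eval, Operand.write, forStep, hm]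
  -- step: `jmp L`
  have s5 : step P w O ρ ⟨some (L + 2 + body.length + 1), forStep w T Q body mem, cp, qs⟩ =
      some ⟨some L, forStep w T Q body mem, cp, qs⟩ := by
    rw [step_jmp (c := ⟨some (L + 2 + body.length + 1), _, cp, qs⟩) rfl
      (by simpa [Nat.add_assoc] using h34.tail.getElem?_zero)]
  have : body.length + 4 = 1 + (1 + (body.length + (1 + 1))) := by omega
  rw [this]
  refine run_add_of_run _ _ _ _ (by rw [run_one, s1]) ?_
  refine run_add_of_run _ _ _ _ (by rw [run_one, s2]) ?_
  refine run_add_of_run _ _ _ _ s3 ?_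
  refine run_add_of_run _ _ _ _ (by rw [run_one, s4]) ?_
  rw [run_one, s5]

/-- **Exit.** If the counter has reached the limit, a `for`-loop jumps to `EXIT` in `2` steps
(clearing the flag `T`). [folklore] -/
theorem run_forLoop_exit (h : CodeAt P L (forLoop T Q LIM L EXIT body)) {mem : ℕ → ℕ}
    (hge : ¬ mem Q < mem LIM) (cp : ℕ) (qs : List (List ℕ)) :
    run P w O ρ 2 ⟨some L, mem, cp, qs⟩ = some ⟨some EXIT, Function.update mem T 0, cp, qs⟩ := by
  have hc : CodeAt P L (([.op .lt (.dir T) (.dir Q) (.dir LIM), .jz (.dir T) EXIT] ++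
      body.map OpSpec.toInstr) ++ [.op .add (.dir Q) (.dir Q) (.imm 1), .jmp L]) := h
  have h12 := (codeAt_append_iff.1 (codeAt_append_iff.1 hc).1).1
  have s1 : step P w O ρ ⟨some L, mem, cp, qs⟩ =
      some ⟨some (L + 1), Function.update mem T 0, cp, qs⟩ := by
    rw [step_op (c := ⟨some L, mem, cp, qs⟩) rfl h12.getElem?_zero]
    simp [BinOp.eval, hge, Operand.write]
  have s2 : step P w O ρ ⟨some (L + 1), Function.update mem T 0, cp, qs⟩ =
      some ⟨some EXIT, Function.update mem T 0, cp, qs⟩ := by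
    rw [step_jz_zero (c := ⟨some (L + 1), _, cp, qs⟩) rfl h12.tail.getElem?_zero (by simp)]
  rw [show (2 : ℕ) = 1 + 1 from rfl]
  exact run_add_of_run _ _ _ _ (by rw [run_one, s1]) (by rw [run_one, s2])

/-- **A whole `for`-loop** (inductive assertions along the iterations, Floyd 1967). As long as
the counter stays below the limit at the loop head, `K` iterations take exactly `K (|body| + 4)`
steps and transform the memory by `forStep^[K]`. [folklore] -/
theorem run_forLoop (h : CodeAt P L (forLoop T Q LIM L EXIT body)) (cp : ℕ)
    (qs : List (List ℕ)) :
    ∀ (K : ℕ) (mem : ℕ → ℕ),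
      (∀ t < K, ((forStep w T Q body)^[t] mem) Q < ((forStep w T Q body)^[t] mem) LIM) →
      run P w O ρ (K * (body.length + 4)) ⟨some L, mem, cp, qs⟩ =
        some ⟨some L, (forStep w T Q body)^[K] mem, cp, qs⟩
  | 0, mem, _ => by simp
  | K + 1, mem, hK => by
    have h0 : mem Q < mem LIM := by simpa using hK 0 (Nat.succ_pos K)
    rw [Nat.succ_mul, Nat.add_comm (K * _), run_add_of_run _ _ _ _ (run_forLoop_iter h h0 cp qs)
      (run_forLoop h cp qs K _ fun t ht => ?_)]
    · rw [← Function.iterate_succ_apply]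
    · rw [← Function.iterate_succ_apply]
      exact hK (t + 1) (Nat.succ_lt_succ ht)

/-- **A whole `for`-loop, through its exit.** `K` iterations while the counter is below the limit,
then the exit test: `K (|body| + 4) + 2` steps from the loop head to `EXIT`, with memory
`forStep^[K]` and the flag cleared. [folklore] -/
theorem run_forLoop_exit_of_iterate (h : CodeAt P L (forLoop T Q LIM L EXIT body)) (cp : ℕ)
    (qs : List (List ℕ)) (K : ℕ) (mem : ℕ → ℕ)
    (hlt : ∀ t < K, ((forStep w T Q body)^[t] mem) Q < ((forStep w T Q body)^[t] mem) LIM)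
    (hge : ¬ ((forStep w T Q body)^[K] mem) Q < ((forStep w T Q body)^[K] mem) LIM) :
    run P w O ρ (K * (body.length + 4) + 2) ⟨some L, mem, cp, qs⟩ =
      some ⟨some EXIT, Function.update ((forStep w T Q body)^[K] mem) T 0, cp, qs⟩ :=
  run_add_of_run _ _ _ _ (run_forLoop h cp qs K mem hlt) (run_forLoop_exit h hge cp qs)

end forLoop

/-! ## Register files -/

/-- A memory whose first `|rs|` cells (the *registers*, addressed by literals in the program) hold
the listed values and whose other cells are given by `heap`. [folklore] -/
def regMem (rs : List ℕ) (heap : ℕ → ℕ) : ℕ → ℕ :=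
  fun a => if h : a < rs.length then rs[a] else heap a

/-- Reading a register. [folklore] -/
theorem regMem_apply_lt {rs : List ℕ} {heap : ℕ → ℕ} {a : ℕ} (h : a < rs.length) :
    regMem rs heap a = rs[a] := by
  simp [regMem, h]

/-- Reading the heap. [folklore] -/
theorem regMem_apply_of_le {rs : List ℕ} {heap : ℕ → ℕ} {a : ℕ} (h : rs.length ≤ a) :
    regMem rs heap a = heap a := by
  simp [regMem, Nat.not_lt.2 h]

/-- Writing a register. [folklore] -/
theorem update_regMem_lt {rs : List ℕ} {heap : ℕ → ℕ} {a : ℕ} (h : a < rs.length) (v : ℕ) :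
    Function.update (regMem rs heap) a v = regMem (rs.set a v) heap := by
  funext b
  by_cases hb : b = a
  · subst hb; simp [regMem, h]
  · rw [Function.update_of_ne hb]
    simp [regMem, List.getElem_set_ne (Ne.symm hb)]

/-- Writing the heap. [folklore] -/
theorem update_regMem_of_le {rs : List ℕ} {heap : ℕ → ℕ} {a : ℕ} (h : rs.length ≤ a) (v : ℕ) :
    Function.update (regMem rs heap) a v = regMem rs (Function.update heap a v) := by
  funext b
  by_cases hb : b = a
  · subst hb; simp [regMem, Nat.not_lt.2 h]
  · rw [Function.update_of_ne hb]
    simp [regMem, Function.update_of_ne hb]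

/-- Two register files with the same registers agree if their heaps agree above the registers.
[folklore] -/
theorem regMem_congr_heap {rs : List ℕ} {heap heap' : ℕ → ℕ}
    (h : ∀ a, rs.length ≤ a → heap a = heap' a) : regMem rs heap = regMem rs heap' := by
  funext a
  unfold regMem
  split
  · rfl
  · exact h a (by omega)

end Literature.Computability.Cryptography.WordRAM
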